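import Summits.Parity.GeneralizedHardyLittlewood.Theses.RoughSemiprimeRigidity

/-!
# Line `birth` — BC3 skeleton for the crux `TwoSidedRigidity` (stmt-Parity-11307)

Route `RoughSemiprimeRigidity` (route-Parity-RoughSemiprimeRigidity; Parity / GeneralizedHardyLittlewood),
crux decl `Summit.Parity.GeneralizedHardyLittlewood.Theses.RoughSemiprimeRigidity.TwoSidedRigidity` (rank 3,
"the mechanism"; rev-3 text, item stmt-Parity-11307). planner-skel-stmt-Parity-11307-0 (skeleton registrar,
one-shot; route re-audit bin REPAIRABLE), 2026-08-17. The crux is FIXED and is concluded BY NAME below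
(`TwoSidedRigidity_of`, `TwoSidedRigidity_proof`); nothing here restates or weakens it.

## The crux (informal)

Write `W(m) = 2 log q · log p` if `m = qp` with primes `m^{1/4} < q < p`, `W(m) = 0` otherwise (log-weighted
ROUGH SEMIPRIMES, `η = 1/4`), `𝔖(h) = singularSeries {0,h}`,
`A_h(N) = Σ_{n ≤ N} W(n) W(n+h)` (rough-semiprime twins), `U_h(N) = Σ_{n ≤ N} Λ(n) log n · Λ(n+h) log(n+h)`
(log-weighted prime twins) and `P_h(N) = Σ_{p ≤ N} log²p · W(p+h)` (the CROSS cell: primes whose shift is a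
rough semiprime). The crux: `EH → ∀ even h ≥ 1, ∀ Bombieri data (X, g) for n ↦ W(n+h) with constant 𝔖(h)`
(Bombieri's (A₁)–(A₅), inlined verbatim as `IsBomb`), `A_h(N) − ¼·U_h(N) = o(N log²N)`.

## The line (the route's own TWO-LAYER PLAN: NearSideLaw → FarSideLaw → TwoSidedRigidity)

Bombieri's asymptotic sieve determines every `P₂`-statistic of a Bombieri sequence up to ONE scalar, its prime
mass; for the weight `W` (`W⁺ = W⁻ = 1 − 2η = ½`) this is the affine law of the route's support item
`BombieriRoughP2Law` (stmt-Parity-11311; Bombieri RIMS 1977 p. 5, `r = 2`, vendored as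
`Literature.NumberTheory.Sieve.Bombieri1976_P2Distribution`):
`Σ_{n ≤ x} W(n) a_n = H·X(x) log x − ½ Σ_{p ≤ x} log²p · a_p + o(X(x) log x)`.
Apply it on BOTH coordinates of the pair `(n, n+h)`:

* `stub_nearSide` (NEAR side, size M given `BombieriRoughP2Law` (L); unconditional in EH): at `a = W(·+h)` with the
  crux's own Bombieri data `(X, g, 𝔖(h))`, using `X(N) = Σ_{m ≤ N} W(m+h) = ½ N log N + O_h(N)` (Chebyshev/Mertens:
  `Σ_{m ≤ y} W(m) = 2 Σ_{y^{1/4} < q ≤ y^{1/2}} log q (θ(y/q) − θ(q)) + O(y) = ½ y log y + O(y)`):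
  `A_h(N) = ½ 𝔖(h) N log²N − ½ P_h(N) + o(N log²N)`.
* `stub_farSide` (FAR side, size M–L given the supports; this is where EH enters): EH makes the shifted primes
  `c_m = log²(m−h)·1_{m−h prime}` a Bombieri sequence with density `1_{(d,h)=1}/φ(d)` and constant `𝔖(h)` (support
  item `ShiftedPrimesBombieri`, stmt-Parity-11312); `BombieriRoughP2Law` at `a = c`, with
  `X_c(N) = Σ_{p ≤ N−h} log²p = N log N + O(N)`, `Σ_{n ≤ N} W(n) c_n = P_h(N − h)`,
  `Σ_{p ≤ N} log²p · c_p = U_h(N − h) + O(√N log⁴N)` (prime powers) and the `h`-shift of the range costing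
  `O_h(log⁴ N)`, gives `P_h(N) = 𝔖(h) N log²N − ½ U_h(N) + o(N log²N)`.
* `TwoSidedRigidity_of` (sorry-free, pure algebra of little-o): `[A − (½𝔖NL² − ½P)] − ½·[P − (𝔖NL² − ½U)] = A − ¼U`,
  so the two stubs give the crux; every free quantity (`𝔖 N log²N`, the cross cell `P_h`) CANCELS and only the
  copy coefficient `(1 − 2η)² = ¼` survives — the "exact copy" mechanism of the route, made kernel-checkable.

Hardest stub: `stub_nearSide` and `stub_farSide` both reduce to ONE unformalised known theorem, Bombieri's
general-weights law for `W` (`BombieriRoughP2Law`), plus PNT-level prime sums; `stub_farSide` additionally needs the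
EH ⇒ level-`x^{1−ε}` passage for shifted primes with the max over `y ≤ x` (tree analogue for `h = 2`:
`hasLevelOfDistribution_shiftedPrimes_of_primesHaveLevel_holds`). Provers: land `BombieriRoughP2Law` /
`ShiftedPrimesBombieri` as the route's support items (they are items, claimable on their own) and cite them.

Disproof used: none exists — `ledger crux ls stmt-Parity-11307` shows no workfiles (no `Disproof.lean`, no
`_false_without_` theorems, no landed `Theorems/TwoSidedRigidity/Negative/*`); `ledger negatives --problem Parity`
(3 entries: ConvMomentLevelOne, TupleElliott, RectangleChowla) contains nothing about `W`, `P_h` or `U_h` — in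
particular no stub asserts a level of distribution for a `Λ⋆Λ`-type weight (the ConvMomentLevelOne witness):
`stub_nearSide` takes the Bombieri data as a HYPOTHESIS exactly as the crux does, `stub_farSide` assumes EH.

BC3 probes (file `bc/TwoSidedRigidity_probes.lean` in the registrar's folder, attached as evidence; `lean check` rc 1,
2026-08-17): for each stub `S ∈ {Sig.stub_nearSide, Sig.stub_farSide}` and target `T ∈ {TwoSidedRigidity,
GeneralizedHardyLittlewood}`, `set_option maxHeartbeats 400000 in example : S → T := by first | exact? | simpa [S] |
(unfold S; simpa) | aesop` FAILS — 4/4 `unsolved goals ⊢ T` (+ `aesop: failed to prove the goal after exhaustive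
search`): no stub is cheaply the crux or the summit. `sorry` occurs ONLY in `stub_nearSide` and `stub_farSide`
(lean check: rc 0, sorries 2, `TwoSidedRigidity_of` axioms = propext / Classical.choice / Quot.sound).

Reshape option for the lead (not done here: "no proving beyond the assembly"): both stubs are (route support item) +
(bookkeeping). The skeleton audit admits route items as by-name hypotheses, so a lead who lands the supports first may
re-cut to `TwoSidedRigidity_of' : BombieriRoughP2Law → ShiftedPrimesBombieri → stub_nearBook → stub_farBook →
TwoSidedRigidity` with `stub_nearBook` = rough-semiprime Mertens `Σ_{m ≤ y} W(m) = ½ y log y + O(y)` + error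
conversion, `stub_farBook` = `Σ_{p ≤ y} log²p = y log y + O(y)`, prime-power and `h`-shift bookkeeping — so that
Bombieri's theorem is formalised ONCE (as `BombieriRoughP2Law`, item stmt-Parity-11311) and not once per side.
-/

noncomputable section

namespace Summit.Parity.GeneralizedHardyLittlewood.Cruxes.TwoSidedRigidity.Birth

open Filter Asymptotics

/-! ## Vocabulary — verbatim the crux's own `let`s and sums (no new objects are posited) -/

/-- The log-weighted rough-semiprime indicator `W` (η = ¼): `W(m) = 2 log q log p` for `m = qp`, primes
`m^{1/4} < q < p`, else `0` — VERBATIM the `let W` of the route decls. [folklore] -/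
def W : ℕ → ℝ :=
  fun m => ∑ q ∈ m.primeFactors, if (m / q).Prime ∧ q < m / q ∧ m < q ^ 4 then 2 * Real.log q * Real.log ((m / q : ℕ) : ℝ) else 0

/-- Bombieri data `(X, g)` with constant `H` for a sequence `a` — Bombieri's (A₁)–(A₅) with size = counting
function and the ordered Euler product for `H`; VERBATIM the `let IsBomb` of the route decls (`Iff.rfl` with
`IsBombieriSequence ∧ HasDensityConstant`, refuter certificates Equiv.lean on the item).
[cite: BombieriRIMS1977, pp. 3-5] -/
def IsBomb : (ℕ → ℝ) → (ℝ → ℝ) → ArithmeticFunction ℝ → ℝ → Prop :=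
  fun a X g H => let R : ℕ → ℝ → ℝ := fun d x => (∑ n ∈ (Finset.Ioc 0 ⌊x⌋₊).filter (d ∣ ·), a n) - g d * X x; g.IsMultiplicative ∧ (∀ n : ℕ, 0 ≤ a n) ∧ ((∀ x : ℝ, X x = ∑ n ∈ (Finset.Ioc 0 ⌊x⌋₊).filter (1 ∣ ·), a n) ∧ ((∀ ε : ℝ, 0 < ε → ∃ C : ℝ, ∀ d : ℕ, 1 ≤ d → |g d| ≤ C * (d : ℝ) ^ (-1 + ε)) ∧ ∀ d : ℕ, 1 < d → g d < 1) ∧ (∀ ε : ℝ, 0 < ε → ∀ B : ℝ, 0 < B → ∃ C : ℝ, ∀ᶠ x : ℝ in Filter.atTop, ∀ y : ℕ → ℝ, (∀ d, y d ≤ x) → ∑ d ∈ Finset.Ico 1 ⌈x ^ (1 - ε)⌉₊, |R d (y d)| ≤ C * X x / Real.log x ^ B) ∧ (∃ (F : ℕ → ℝ) (c₁ c₂ : ℝ), 0 < c₁ ∧ 0 < c₂ ∧ (∀ ε : ℝ, 0 < ε → ∃ C : ℝ, ∀ d : ℕ, 1 ≤ d → |F d| ≤ C * (d : ℝ) ^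 ε) ∧ ((fun x : ℝ => ∑ d ∈ Finset.Ico 1 ⌈x⌉₊, F d ^ 2 / d) =O[Filter.atTop] fun x : ℝ => Real.log x ^ c₂) ∧ ∃ C : ℝ, ∀ᶠ x : ℝ in Filter.atTop, ∀ d : ℕ, 1 ≤ d → (d : ℝ) < x → |R d x| ≤ C * (F d / d) * X x * Real.log x ^ c₁) ∧ (((fun x : ℝ => ∫ t in (1 : ℝ)..x, X t / t) =o[Filter.atTop] fun x : ℝ => X x * Real.log x) ∧ (fun x : ℝ => X (Real.sqrt x)) =o[Filter.atTop] fun x : ℝ => X x / Real.log x) ∧ (∃ η₁ : ℝ, 0 < η₁ ∧ ∃ b : ℕ → ℂ, (∀ s : ℂ, -η₁ < s.re → LSeriesSummable b s) ∧ LSeries b 0 ≠ 0 ∧ ∀ s : ℂ, 0 < s.re → LSeries (fun d => ((g d : ℝ) : ℂ)) s = riemannZeta (s + 1) * LSeries b s)) ∧ Filter.Tendsto (fun x : ℕ => ∏ p ∈ Nat.primesLE x, (1 - g p) / (1 - (p : ℝ)⁻¹)) Filter.atTop (nhds H)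

/-- `𝔖(h) = singularSeries {0, h}`, the Hardy–Littlewood pair constant (verbatim the crux's constant). [folklore] -/
def singSer (h : ℕ) : ℝ :=
  Literature.NumberTheory.Sieve.singularSeries ({0, (h : ℤ)} : Finset ℤ)

/-- `A_h(N) = Σ_{1 ≤ n ≤ N} W(n) W(n+h)` — rough-semiprime twins (verbatim the crux's first sum). [folklore] -/
def roughTwinSum (h N : ℕ) : ℝ :=
  ∑ n ∈ Finset.Icc 1 N, W n * W (n + h)

/-- `U_h(N) = Σ_{1 ≤ n ≤ N} Λ(n) log n · Λ(n+h) log(n+h)` — log-weighted prime twins (verbatim the crux's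
second sum). [folklore] -/
def primeTwinSum (h N : ℕ) : ℝ :=
  ∑ n ∈ Finset.Icc 1 N, ArithmeticFunction.vonMangoldt n * Real.log n *
    (ArithmeticFunction.vonMangoldt (n + h) * Real.log ((n + h : ℕ) : ℝ))

/-- `P_h(N) = Σ_{p ≤ N} log²p · W(p+h)` — the CROSS cell (primes `p` whose shift `p + h` is a rough semiprime),
verbatim the secondary term of `BombieriRoughP2Law` at `a = W(·+h)`, `x = N`. [folklore] -/
def crossSum (h N : ℕ) : ℝ :=
  ∑ p ∈ Nat.primesLE N, Real.log p ^ 2 * W (p + h)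

/-! ## The two registered stubs (the ONLY `sorry`s of this file; their statements are repeated below as the named `Prop`s `Sig.stub_*`) -/

/-- **Stub 1 — NEAR-SIDE LAW** (size M given `BombieriRoughP2Law`; no EH). For every even `h ≥ 1` and all
Bombieri data `(X, g)` for `n ↦ W(n+h)` with constant `𝔖(h)` (the crux's own hypothesis, verbatim):
`A_h(N) − (½·𝔖(h)·N·log²N − ½·P_h(N)) = o(N log²N)`.
Proof plan: `BombieriRoughP2Law` (route support item stmt-Parity-11311 = Bombieri's general-weights theorem,
RIMS 1977 p. 5 at `r = 2`, `G = 2u(1−u)1_{(1/4,1/2]}`, `∫G dμ₂ = ½`) at `a = W(·+h)`, `H = 𝔖(h)`: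
`Σ_{n≤x} W(n)W(n+h) = 𝔖 X(x) log x − ½ Σ_{p≤x} log²p W(p+h) + o(X(x) log x)`; then `X(x) = Σ_{n ≤ x} W(n+h)`
((A₁), first clause of `IsBomb`) `= ½ x log x + O_h(x)` by Chebyshev–Mertens for rough semiprimes.
Why it might fail: only through a mis-normalisation of `BombieriRoughP2Law` (coefficient of the secondary term;
refuters re-derived `½` from RIMS p. 5 and the survey p. 40, numerics consistent). Leans on: `BombieriRoughP2Law`
(unproved item), `Literature.NumberTheory.Sieve.Bombieri1976_P2Distribution` (vendored fact), Mathlib/tree PNT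
(`θ(x) ∼ x`). [cite: BombieriRIMS1977, p. 5 Theorem (r = 2)] -/
theorem stub_nearSide :
    ∀ h : ℕ, 1 ≤ h → Even h → ∀ (X : ℝ → ℝ) (g : ArithmeticFunction ℝ),
      IsBomb (fun n : ℕ => W (n + h)) X g (singSer h) →
      (fun N : ℕ => roughTwinSum h N -
          ((1 / 2 : ℝ) * singSer h * N * Real.log N ^ 2 - (1 / 2 : ℝ) * crossSum h N))
        =o[Filter.atTop] fun N : ℕ => (N : ℝ) * Real.log N ^ 2 := by
  sorry

/-- **Stub 2 — FAR-SIDE LAW** (size M–L given the supports; the EH content of the crux). Under EH (the route item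
`EH`, `Iff.rfl` with the crux's inlined antecedent), for every even `h ≥ 1`:
`P_h(N) − (𝔖(h)·N·log²N − ½·U_h(N)) = o(N log²N)`.
Proof plan: `ShiftedPrimesBombieri` (route support item stmt-Parity-11312): EH ⇒ `c_m = log²(m−h)1_{m−h prime}`
carries Bombieri data with density `1_{(d,h)=1}/φ(d)` and constant `𝔖(h)`; `BombieriRoughP2Law` at `a = c`:
`Σ_{n≤x} W(n)c_n = 𝔖 X_c(x) log x − ½ Σ_{p≤x} log²p c_p + o(X_c log x)` with `X_c(x) = Σ_{p ≤ x−h} log²p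
= x log x + O(x)`, `Σ_{n ≤ N} W(n) c_n = P_h(N−h)`, `Σ_{p ≤ N} log²p c_p = U_h(N−h) + O(√N log⁴N)` (prime powers),
and the `h`-shift of the range costs `O_h(log⁴N)`.
Why it might fail: as for stub 1, plus the max-over-`y ≤ x` / all-reduced-residues form of (A₂) for shifted primes
must really follow from the item `EH` as typed (it is the standard EH; tree analogue for `h = 2`:
`hasLevelOfDistribution_shiftedPrimes_of_primesHaveLevel_holds`). Leans on: `EH` (open conjecture, hypothesis),
`ShiftedPrimesBombieri`, `BombieriRoughP2Law` (unproved items), PNT. [cite: BombieriRIMS1977, p. 5 Theorem (r = 2)] -/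
theorem stub_farSide :
    Summit.Parity.GeneralizedHardyLittlewood.Theses.RoughSemiprimeRigidity.EH →
      ∀ h : ℕ, 1 ≤ h → Even h →
      (fun N : ℕ => crossSum h N -
          (singSer h * N * Real.log N ^ 2 - (1 / 2 : ℝ) * primeTwinSum h N))
        =o[Filter.atTop] fun N : ℕ => (N : ℝ) * Real.log N ^ 2 := by
  sorry

/-! ## The two stub statements as named propositions `Sig.stub_<name>`

The skeleton audit reads the hypotheses of `TwoSidedRigidity_of` BY NAME: a hypothesis whose head constant is
named like a registered stub is a declared obligation of the line. The registered stubs above state the same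
text spelled out (so that a `Theorems/` file can prove a stub over Mathlib + the route file + the six vocabulary
abbreviations without importing this file); `TwoSidedRigidity_proof` type-checks only because they agree. -/

/-- `Sig.stub_nearSide` — the statement of `stub_nearSide` (NEAR-SIDE LAW), as a named `Prop`. [folklore] -/
def Sig.stub_nearSide : Prop :=
  ∀ h : ℕ, 1 ≤ h → Even h → ∀ (X : ℝ → ℝ) (g : ArithmeticFunction ℝ),
    IsBomb (fun n : ℕ => W (n + h)) X g (singSer h) →
    (fun N : ℕ => roughTwinSum h N -
        ((1 / 2 : ℝ) * singSer h * N * Real.log N ^ 2 - (1 / 2 : ℝ) * crossSum h N))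
      =o[Filter.atTop] fun N : ℕ => (N : ℝ) * Real.log N ^ 2

/-- `Sig.stub_farSide` — the statement of `stub_farSide` (FAR-SIDE LAW), as a named `Prop`. [folklore] -/
def Sig.stub_farSide : Prop :=
  Summit.Parity.GeneralizedHardyLittlewood.Theses.RoughSemiprimeRigidity.EH →
    ∀ h : ℕ, 1 ≤ h → Even h →
    (fun N : ℕ => crossSum h N -
        (singSer h * N * Real.log N ^ 2 - (1 / 2 : ℝ) * primeTwinSum h N))
      =o[Filter.atTop] fun N : ℕ => (N : ℝ) * Real.log N ^ 2

/-! ## The composition: NEAR ∧ FAR ⟹ the crux, BY NAME (sorry-free) -/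

/-- **THE SKELETON THEOREM.** `Sig.stub_nearSide → Sig.stub_farSide → TwoSidedRigidity` (stub₁-sig → stub₂-sig →
crux) — a real proof, no
`sorry`: the crux's `let W` / `let IsBomb` / inlined EH are definitionally this file's `W` / `IsBomb` / the item
`EH` (`show`), and for even `h` with Bombieri data `(X, g)`:
`(A − (½𝔖NL² − ½P)) − ½·(P − (𝔖NL² − ½U)) = A − ¼U` identically in `N` (`ring`), so
`IsLittleO.sub` / `const_mul_left` conclude. Both stubs are consumed; nothing else is assumed. [folklore] -/
theorem TwoSidedRigidity_of :
    Sig.stub_nearSide → Sig.stub_farSide →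
      Summit.Parity.GeneralizedHardyLittlewood.Theses.RoughSemiprimeRigidity.TwoSidedRigidity := by
  intro hNear hFar
  show Summit.Parity.GeneralizedHardyLittlewood.Theses.RoughSemiprimeRigidity.EH →
      ∀ h : ℕ, 1 ≤ h → Even h → ∀ (X : ℝ → ℝ) (g : ArithmeticFunction ℝ),
        IsBomb (fun n : ℕ => W (n + h)) X g (singSer h) →
        (fun N : ℕ => roughTwinSum h N - (1 / 4 : ℝ) * primeTwinSum h N)
          =o[Filter.atTop] fun N : ℕ => (N : ℝ) * Real.log N ^ 2
  intro hEH h hh he X g hX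
  have h1 := hNear h hh he X g hX
  have h2 := hFar hEH h hh he
  have h3 := h1.sub (h2.const_mul_left (1 / 2 : ℝ))
  refine h3.congr_left ?_
  intro N
  ring

/-- The skeleton in its final shape: the crux BY NAME from the two registered stubs; it becomes the crux proof when
both `stub_*` are discharged (until then it depends on `sorryAx` through the stubs only — no `sorry` of its own).
[folklore] -/
theorem TwoSidedRigidity_proof :
    Summit.Parity.GeneralizedHardyLittlewood.Theses.RoughSemiprimeRigidity.TwoSidedRigidity :=
  TwoSidedRigidity_of stub_nearSide stub_farSide

end Summit.Parity.GeneralizedHardyLittlewood.Cruxes.TwoSidedRigidity.Birth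

end
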